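import Mathlib
import Literature.NumberTheory.Sieve.BombieriVinogradovReduction
import Literature.NumberTheory.Sieve.MontgomeryVaughan1975GaussSums

/-!
# Replication inequality for the high-conductor part of the prime discrepancy

Crux `stmt-Parity-11314` (`EH`, the Elliott–Halberstam conjecture), line
*upward-replication-free-factorability*, stub `stub_replication`.  For a cut `D : ℕ`, a modulus
`q ≥ 1`, a unit `a mod q` and a height `x` put (`ψ(x, χ) = ∑_{n ≤ x} χ(n) Λ(n)`,
`Literature.NumberTheory.Sieve.chebyshevPsiChar`)

  `Δ♯_D(x; q, a) = φ(q)⁻¹ ∑_{χ mod q, cond χ > D} χ(a⁻¹) ψ(x, χ)`,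
  `E♯_D(x; q) = max_a ‖Δ♯_D(x; q, a)‖`,

the part of the character expansion of `ψ(x; q, a)` (Davenport, ch. 28) carried by the characters of
conductor `> D`.  The theorem: for a prime `p ∤ q`,

  `E♯_D(x; q) ≤ (p − 1) · E♯_D(x; q p) + R(qp, x)`,  `R(m, x) = ∑_{n ≤ x, (n, m) > 1} Λ(n)`
  (`Literature.NumberTheory.Sieve.nonCoprimePart`).

Proof.  Fix a unit `a mod q` and let `F` be the fibre of `a⁻¹` under the reduction
`f : (ℤ/qp)ˣ → (ℤ/q)ˣ` (`ZMod.unitsMap`); `#F · φ(q) = φ(qp)` (the tree's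
`MontgomeryVaughan1975.card_fiber_mul_totient`), so `#F = p − 1`.  Summing `Δ♯_D(x; qp, b⁻¹)` over
`b ∈ F` and swapping sums, each character `χ mod qp` appears with the fibre sum `∑_{b ∈ F} χ(b)`,
which vanishes unless `χ` factors through `q`
(`MontgomeryVaughan1975.sum_fiber_eq_zero_of_not_factorsThrough`, i.e. orthogonality on `ker f`,
Mathlib's `DirichletCharacter.factorsThrough_iff_ker_unitsMap`), and
equals `#F · χ₁(a⁻¹)` if `χ = changeLevel χ₁`; the conductor is unchanged under `changeLevel`
(`DirichletCharacter.conductor_changeLevel`) and `changeLevel` is injective, so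

  `∑_{b ∈ F} Δ♯_D(x; qp, b⁻¹) = φ(q)⁻¹ ∑_{χ₁ mod q, cond χ₁ > D} χ₁(a⁻¹) ψ(x, changeLevel χ₁)`.

Finally `‖ψ(x, changeLevel χ₁) − ψ(x, χ₁)‖ ≤ R(qp, x)`
(`Literature.NumberTheory.Sieve.norm_chebyshevPsiChar_changeLevel_sub_le`), `‖χ₁(a⁻¹)‖ ≤ 1` and
`#{χ₁ mod q} = φ(q)` give `‖Δ♯_D(x; q, a)‖ ≤ ∑_{b ∈ F} ‖Δ♯_D(x; qp, b⁻¹)‖ + R(qp, x)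
≤ (p − 1) E♯_D(x; qp) + R(qp, x)`.

References: H. Davenport, *Multiplicative Number Theory*, 2nd ed., GTM 74 (1980), ch. 28
[DavenportMNT1980]; H. L. Montgomery, R. C. Vaughan, *Multiplicative Number Theory I*, CUP 2007,
§9.1 (induced characters) [MontgomeryVaughan2007].
-/

open Finset

namespace Summit.Parity.GeneralizedHardyLittlewood.Theorems.EH.Replication

open Literature.NumberTheory.Sieve

/-- Fibre sum of an induced character: if `χ = changeLevel χ₁` (`χ₁ mod d`, `d ∣ n`) then
`∑_{b ∈ (ℤ/n)ˣ, b ↦ y} χ(b) = #{b ↦ y} · χ₁(y)`. [folklore] -/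
theorem sum_fiber_changeLevel_eq_card_mul {n d : ℕ} [NeZero n] (hd : d ∣ n)
    (χ₁ : DirichletCharacter ℂ d) (y : (ZMod d)ˣ) :
    ∑ b ∈ (univ : Finset (ZMod n)ˣ).filter (fun b => ZMod.unitsMap hd b = y),
        DirichletCharacter.changeLevel hd χ₁ (b : ZMod n) =
      (((univ : Finset (ZMod n)ˣ).filter (fun b => ZMod.unitsMap hd b = y)).card : ℂ) *
        χ₁ (y : ZMod d) := by
  have hterm : ∀ b ∈ (univ : Finset (ZMod n)ˣ).filter (fun b => ZMod.unitsMap hd b = y),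
      DirichletCharacter.changeLevel hd χ₁ (b : ZMod n) = χ₁ (y : ZMod d) := by
    intro b hb
    rw [← MulChar.coe_toUnitHom, DirichletCharacter.changeLevel_toUnitHom, MonoidHom.comp_apply,
      (mem_filter.mp hb).2, MulChar.coe_toUnitHom]
  rw [sum_congr rfl hterm, sum_const, nsmul_eq_mul]

/-- Orthogonality on the kernel, summed against `ψ(x, χ)` over the characters of conductor `> D`:
`∑_{χ mod n, cond χ > D} (∑_{b ↦ y} χ(b)) ψ(x, χ)
  = #{b ↦ y} ∑_{χ₁ mod d, cond χ₁ > D} χ₁(y) ψ(x, χ₁χ₀)`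
(characters not factoring through `d` have vanishing fibre sums; the others are `changeLevel χ₁`
for a unique `χ₁` of the same conductor). [cite: DavenportMNT1980, ch. 28] -/
theorem sum_filter_fiberSum_mul_eq {n d : ℕ} [NeZero n] (hd : d ∣ n) (y : (ZMod d)ˣ) (D : ℕ)
    (x : ℝ) :
    ∑ χ ∈ (univ : Finset (DirichletCharacter ℂ n)) with D < χ.conductor,
        (∑ b ∈ (univ : Finset (ZMod n)ˣ).filter (fun b => ZMod.unitsMap hd b = y), χ (b : ZMod n)) *
          chebyshevPsiChar χ x =
      (((univ : Finset (ZMod n)ˣ).filter (fun b => ZMod.unitsMap hd b = y)).card : ℂ) *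
        ∑ χ₁ ∈ (univ : Finset (DirichletCharacter ℂ d)) with D < χ₁.conductor,
          χ₁ (y : ZMod d) * chebyshevPsiChar (DirichletCharacter.changeLevel hd χ₁) x := by
  rw [mul_sum]
  symm
  refine sum_of_injOn (DirichletCharacter.changeLevel hd)
    (DirichletCharacter.changeLevel_injective hd).injOn ?_ ?_ ?_
  · intro χ₁ hχ₁
    rw [mem_coe, mem_filter] at hχ₁ ⊢
    refine ⟨mem_univ _, ?_⟩
    rw [DirichletCharacter.conductor_changeLevel]
    exact hχ₁.2
  · intro χ hχ hχ'
    by_cases hfac : χ.FactorsThrough d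
    · obtain ⟨hd', χ₁, rfl⟩ := hfac
      exfalso
      refine hχ' ⟨χ₁, ?_, rfl⟩
      rw [mem_filter] at hχ
      rw [mem_coe, mem_filter]
      refine ⟨mem_univ _, ?_⟩
      rw [← DirichletCharacter.conductor_changeLevel χ₁ hd]
      exact hχ.2
    · rw [MontgomeryVaughan1975.sum_fiber_eq_zero_of_not_factorsThrough χ hd hfac y, zero_mul]
  · intro χ₁ _
    rw [sum_fiber_changeLevel_eq_card_mul hd χ₁ y]
    ring

/-- The replication inequality at one reduced class `a mod q` (`p ∤ q` prime):
`‖Δ♯_D(x; q, a)‖ ≤ (p − 1) E♯_D(x; qp) + R(qp, x)`. [cite: DavenportMNT1980, ch. 28] -/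
theorem norm_highConductorPart_le {q p : ℕ} [NeZero q] (hp : p.Prime) (hpq : ¬ p ∣ q) (D : ℕ)
    (x : ℝ) (a : (ZMod q)ˣ) :
    ‖((Nat.totient q : ℂ))⁻¹ *
        ∑ χ ∈ (Finset.univ : Finset (DirichletCharacter ℂ q)) with D < χ.conductor,
          χ (a : ZMod q)⁻¹ * Literature.NumberTheory.Sieve.chebyshevPsiChar χ x‖ ≤
      ((p : ℝ) - 1) *
          (⨆ a : (ZMod (q * p))ˣ,
            ‖((Nat.totient (q * p) : ℂ))⁻¹ *
                ∑ χ ∈ (Finset.univ : Finset (DirichletCharacter ℂ (q * p))) with D < χ.conductor,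
                  χ (a : ZMod (q * p))⁻¹ * Literature.NumberTheory.Sieve.chebyshevPsiChar χ x‖) +
        Literature.NumberTheory.Sieve.nonCoprimePart (q * p) x := by
  haveI : NeZero (q * p) := ⟨Nat.mul_ne_zero (NeZero.ne q) hp.ne_zero⟩
  have h : q ∣ q * p := dvd_mul_right q p
  set F := (univ : Finset (ZMod (q * p))ˣ).filter (fun b => ZMod.unitsMap h b = a⁻¹)
  -- cardinalities
  have hφq : 0 < Nat.totient q := Nat.totient_pos.2 (NeZero.pos q)
  have hφn : 0 < Nat.totient (q * p) := Nat.totient_pos.2 (NeZero.pos _)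
  have hcardφ : F.card * Nat.totient q = Nat.totient (q * p) :=
    MontgomeryVaughan1975.card_fiber_mul_totient h a⁻¹
  have hcop : q.Coprime p := Nat.coprime_comm.1 ((Nat.Prime.coprime_iff_not_dvd hp).2 hpq)
  have hcard : F.card = p - 1 := by
    have h1 : F.card * Nat.totient q = (p - 1) * Nat.totient q := by
      rw [hcardφ, Nat.totient_mul hcop, Nat.totient_prime hp, mul_comm]
    exact Nat.eq_of_mul_eq_mul_right hφq h1
  have hscal : ((Nat.totient (q * p) : ℂ))⁻¹ * (F.card : ℂ) = ((Nat.totient q : ℂ))⁻¹ := by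
    refine eq_inv_of_mul_eq_one_left ?_
    have hc : (F.card : ℂ) * (Nat.totient q : ℂ) = (Nat.totient (q * p) : ℂ) := by
      exact_mod_cast hcardφ
    rw [mul_assoc, hc, inv_mul_cancel₀ (by exact_mod_cast hφn.ne')]
  -- (iii) the sum of `Δ♯_D(x; qp, b⁻¹)` over the fibre
  have key : ∑ b ∈ F, ((Nat.totient (q * p) : ℂ))⁻¹ *
        ∑ χ ∈ (univ : Finset (DirichletCharacter ℂ (q * p))) with D < χ.conductor,
          χ (((b⁻¹ : (ZMod (q * p))ˣ) : ZMod (q * p)))⁻¹ * chebyshevPsiChar χ x =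
      ((Nat.totient q : ℂ))⁻¹ *
        ∑ χ₁ ∈ (univ : Finset (DirichletCharacter ℂ q)) with D < χ₁.conductor,
          χ₁ (a : ZMod q)⁻¹ * chebyshevPsiChar (DirichletCharacter.changeLevel h χ₁) x := by
    simp_rw [ZMod.inv_coe_unit, inv_inv]
    rw [← mul_sum, sum_comm]
    simp_rw [← sum_mul]
    rw [sum_filter_fiberSum_mul_eq h a⁻¹ D x, ← mul_assoc, hscal]
  -- `Δ♯_D(x; q, a) = ∑_{b ∈ F} Δ♯_D(x; qp, b⁻¹) − φ(q)⁻¹ ∑ χ₁(a⁻¹) (ψ(x, χ₁χ₀) − ψ(x, χ₁))`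
  have hdec : ((Nat.totient q : ℂ))⁻¹ *
        ∑ χ ∈ (univ : Finset (DirichletCharacter ℂ q)) with D < χ.conductor,
          χ (a : ZMod q)⁻¹ * chebyshevPsiChar χ x =
      (∑ b ∈ F, ((Nat.totient (q * p) : ℂ))⁻¹ *
        ∑ χ ∈ (univ : Finset (DirichletCharacter ℂ (q * p))) with D < χ.conductor,
          χ (((b⁻¹ : (ZMod (q * p))ˣ) : ZMod (q * p)))⁻¹ * chebyshevPsiChar χ x) -
      ((Nat.totient q : ℂ))⁻¹ *
        ∑ χ₁ ∈ (univ : Finset (DirichletCharacter ℂ q)) with D < χ₁.conductor,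
          χ₁ (a : ZMod q)⁻¹ * (chebyshevPsiChar (DirichletCharacter.changeLevel h χ₁) x -
            chebyshevPsiChar χ₁ x) := by
    rw [key, ← mul_sub, ← sum_sub_distrib]
    congr 1
    exact sum_congr rfl fun χ₁ _ => by ring
  -- (iv) the remainder
  have hR := nonCoprimePart_nonneg (q * p) x
  have hrem : ‖((Nat.totient q : ℂ))⁻¹ *
        ∑ χ₁ ∈ (univ : Finset (DirichletCharacter ℂ q)) with D < χ₁.conductor,
          χ₁ (a : ZMod q)⁻¹ * (chebyshevPsiChar (DirichletCharacter.changeLevel h χ₁) x -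
            chebyshevPsiChar χ₁ x)‖ ≤ nonCoprimePart (q * p) x := by
    rw [norm_mul, norm_inv, Complex.norm_natCast]
    calc ((Nat.totient q : ℝ))⁻¹ * ‖∑ χ₁ ∈ (univ : Finset (DirichletCharacter ℂ q)) with
            D < χ₁.conductor, χ₁ (a : ZMod q)⁻¹ *
              (chebyshevPsiChar (DirichletCharacter.changeLevel h χ₁) x - chebyshevPsiChar χ₁ x)‖
        ≤ ((Nat.totient q : ℝ))⁻¹ * ∑ χ₁ ∈ (univ : Finset (DirichletCharacter ℂ q)) with
            D < χ₁.conductor, nonCoprimePart (q * p) x := by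
          gcongr
          refine (norm_sum_le _ _).trans (sum_le_sum fun χ₁ _ => ?_)
          rw [norm_mul]
          calc ‖χ₁ (a : ZMod q)⁻¹‖ *
                ‖chebyshevPsiChar (DirichletCharacter.changeLevel h χ₁) x - chebyshevPsiChar χ₁ x‖
              ≤ 1 * nonCoprimePart (q * p) x :=
                mul_le_mul (χ₁.norm_le_one _) (norm_chebyshevPsiChar_changeLevel_sub_le h χ₁ x)
                  (norm_nonneg _) zero_le_one
            _ = nonCoprimePart (q * p) x := one_mul _
      _ ≤ ((Nat.totient q : ℝ))⁻¹ * ∑ _χ₁ : DirichletCharacter ℂ q, nonCoprimePart (q * p) x :=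
          mul_le_mul_of_nonneg_left
            (sum_le_sum_of_subset_of_nonneg (filter_subset _ _) fun _ _ _ => hR)
            (inv_nonneg.2 (Nat.cast_nonneg _))
      _ = nonCoprimePart (q * p) x := by
          rw [sum_const, card_univ, ← Nat.card_eq_fintype_card,
            DirichletCharacter.card_eq_totient_of_hasEnoughRootsOfUnity ℂ q, nsmul_eq_mul,
            inv_mul_cancel_left₀ (by exact_mod_cast hφq.ne')]
  -- (iv') the fibre terms, each at most `E♯_D(x; qp)`
  have hfib : ‖∑ b ∈ F, ((Nat.totient (q * p) : ℂ))⁻¹ *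
        ∑ χ ∈ (univ : Finset (DirichletCharacter ℂ (q * p))) with D < χ.conductor,
          χ (((b⁻¹ : (ZMod (q * p))ˣ) : ZMod (q * p)))⁻¹ * chebyshevPsiChar χ x‖ ≤
      ((p : ℝ) - 1) *
        ⨆ c : (ZMod (q * p))ˣ, ‖((Nat.totient (q * p) : ℂ))⁻¹ *
          ∑ χ ∈ (univ : Finset (DirichletCharacter ℂ (q * p))) with D < χ.conductor,
            χ (c : ZMod (q * p))⁻¹ * chebyshevPsiChar χ x‖ := by
    refine (norm_sum_le _ _).trans ?_
    refine (sum_le_sum fun b _ => Finite.le_ciSup (fun c : (ZMod (q * p))ˣ =>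
      ‖((Nat.totient (q * p) : ℂ))⁻¹ *
          ∑ χ ∈ (univ : Finset (DirichletCharacter ℂ (q * p))) with D < χ.conductor,
            χ (c : ZMod (q * p))⁻¹ * chebyshevPsiChar χ x‖) b⁻¹).trans ?_
    rw [sum_const, hcard, nsmul_eq_mul, Nat.cast_sub hp.one_le, Nat.cast_one]
  rw [hdec]
  exact (norm_sub_le _ _).trans (add_le_add hfib hrem)

/-- **Replication inequality for `Δ♯`** (stub `stub_replication` of the line
`upward-replication-free-factorability` for `EH`): for any cut `D`, `x ≥ 1`, `q ≥ 1` and a prime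
`p ∤ q`, `E♯_D(x; q) ≤ (p − 1) · E♯_D(x; q·p) + R(qp, x)` with
`R(m, x) = ∑_{n ≤ x, (n,m) > 1} Λ(n)` (`Literature.NumberTheory.Sieve.nonCoprimePart`).
[cite: DavenportMNT1980, ch. 28] -/
theorem stub_replication :
    ∀ (D : ℕ) (x : ℝ), 1 ≤ x → ∀ q : ℕ, 1 ≤ q → ∀ p : ℕ, p.Prime → ¬ p ∣ q →
      (⨆ a : (ZMod q)ˣ,
          ‖((Nat.totient q : ℂ))⁻¹ *
              ∑ χ ∈ (Finset.univ : Finset (DirichletCharacter ℂ q)) with D < χ.conductor,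
                χ (a : ZMod q)⁻¹ * Literature.NumberTheory.Sieve.chebyshevPsiChar χ x‖) ≤
        ((p : ℝ) - 1) *
            (⨆ a : (ZMod (q * p))ˣ,
              ‖((Nat.totient (q * p) : ℂ))⁻¹ *
                  ∑ χ ∈ (Finset.univ : Finset (DirichletCharacter ℂ (q * p))) with D < χ.conductor,
                    χ (a : ZMod (q * p))⁻¹ * Literature.NumberTheory.Sieve.chebyshevPsiChar χ x‖) +
          Literature.NumberTheory.Sieve.nonCoprimePart (q * p) x := by
  intro D x _ q hq p hp hpq
  haveI : NeZero q := ⟨by omega⟩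
  exact ciSup_le fun a => norm_highConductorPart_le hp hpq D x a

end Summit.Parity.GeneralizedHardyLittlewood.Theorems.EH.Replication
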